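import Summits.AtomisticToContinuum.FouriersLaw.Theorems.EmbeddedDrudeMourreFGRGapGenericA

/-!
# FGRGap, line `fold-jet-rigidity` — fibre genericity, part B: the partner map along a fibre

Support file for the registered stub `stub_fibreGenericity` (GB) of crux `EmbeddedDrudeMourre.FGRGap`
(item stmt-AtomisticToContinuum-12595); continues `…GenericA`. For a partner map `h` with the GA
properties (each lemma takes exactly the clauses it uses): off the equal-velocity curve
`{v k₃ = v k₁}` the coincidences `v₁ = v₄` and `v₂ = v₃` are excluded POINTWISE (the outgoing swap
`k₃ ↔ k₄` resp. the incoming swap `k₁ ↔ k₂` of `Ω` moves the chart point onto the curve, where the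
two-root structure leaves only the exchange root, forcing `k₃ ≡ k₁`); at a point `β` of the curve every
resonant partner `L` makes `∏ sin(k_j/2)` a square, so the vertex `a + 16b∏` (`a > 0`, `b ≥ 0`) cannot
vanish along a sequence `k₃ → β` (cluster value + continuity of `Ω`); and the GA lifts restrict to
analytic fibre lifts `φ₁ ≡ h k₁ · (mod 2π)` with `φ₁' = (v₃-v₄)/(v₂-v₄)`, through which `v(h)`, `v(k₄)`
and the vertex are real-analytic along the fibre (they see the lift only mod `2π`). Ends with the
helper stub `stub_fibreGenericity_partB`.
-/

noncomputable section

open MeasureTheory Set Real Filter Topology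
open scoped ENNReal
open Literature.MathematicalPhysics.KineticTheory.PhononBoltzmann
open Summit.AtomisticToContinuum.FouriersLaw.Theorems.FGRGap

namespace Summit.AtomisticToContinuum.FouriersLaw.Theorems.FGRGap.FoldJetRigidity.Generic

variable {ω₂ : ℝ}

/-! ## Part B: pointwise consequences of the two-root structure; the diagonal/curve endpoint;
analyticity along the fibres -/

section PartB

variable {h : ℝ → ℝ → ℝ}

/-- Off the equal-velocity curve the partner is not the exchange root `k₃ mod 2π`. -/
theorem partner_ne_toIocMod
    (htriv : ∀ k₁ k₃ : ℝ, (∀ n : ℤ, k₃ - k₁ ≠ n * (2 * π)) →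
      (h k₁ k₃ = toIocMod Real.two_pi_pos (-π) k₃ ↔ groupVelocity ω₂ k₃ = groupVelocity ω₂ k₁))
    {k₁ k₃ : ℝ} (hW : groupVelocity ω₂ k₃ ≠ groupVelocity ω₂ k₁) :
    h k₁ k₃ ≠ toIocMod Real.two_pi_pos (-π) k₃ :=
  fun heq => hW ((htriv k₁ k₃ (sub_ne_of_groupVelocity_ne hW)).1 heq)

/-- Off the equal-velocity curve the partner is not congruent to `k₃`. -/
theorem partner_sub_ne (hcell : ∀ k₁ k₃ : ℝ, h k₁ k₃ ∈ Set.Ioc (-π) π)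
    (htriv : ∀ k₁ k₃ : ℝ, (∀ n : ℤ, k₃ - k₁ ≠ n * (2 * π)) →
      (h k₁ k₃ = toIocMod Real.two_pi_pos (-π) k₃ ↔ groupVelocity ω₂ k₃ = groupVelocity ω₂ k₁))
    {k₁ k₃ : ℝ} (hW : groupVelocity ω₂ k₃ ≠ groupVelocity ω₂ k₁) :
    ∀ n : ℤ, h k₁ k₃ - k₃ ≠ n * (2 * π) :=
  fun n hn => partner_ne_toIocMod htriv hW (eq_toIocMod_of_mem_cell (hcell k₁ k₃) ⟨n, hn⟩)

/-- **`v₁ = v₄` forces the curve** (outgoing swap `k₃ ↔ k₄`): off the equal-velocity curve,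
`v(k₄) ≠ v(k₁)` for `k₄ = k₁ + h - k₃`. -/
theorem groupVelocity_k4_ne_k1 (hcell : ∀ k₁ k₃ : ℝ, h k₁ k₃ ∈ Set.Ioc (-π) π)
    (hres : ∀ k₁ k₃ : ℝ, resonanceFn ω₂ k₁ (h k₁ k₃) k₃ = 0)
    (htwo : ∀ k₁ k₃ : ℝ, (∀ n : ℤ, k₃ - k₁ ≠ n * (2 * π)) →
      resonantSet ω₂ k₁ k₃ = {toIocMod Real.two_pi_pos (-π) k₃, h k₁ k₃})
    (htriv : ∀ k₁ k₃ : ℝ, (∀ n : ℤ, k₃ - k₁ ≠ n * (2 * π)) →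
      (h k₁ k₃ = toIocMod Real.two_pi_pos (-π) k₃ ↔ groupVelocity ω₂ k₃ = groupVelocity ω₂ k₁))
    {k₁ k₃ : ℝ} (hW : groupVelocity ω₂ k₃ ≠ groupVelocity ω₂ k₁) :
    groupVelocity ω₂ (k₁ + h k₁ k₃ - k₃) ≠ groupVelocity ω₂ k₁ := by
  intro heq
  set y := h k₁ k₃ with hy
  have hoff : ∀ n : ℤ, k₁ + y - k₃ - k₁ ≠ n * (2 * π) := fun n hn =>
    partner_sub_ne hcell htriv hW n (by rw [← hy]; linarith)
  have h4 : h k₁ (k₁ + y - k₃) = toIocMod Real.two_pi_pos (-π) (k₁ + y - k₃) :=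
    (htriv k₁ _ hoff).2 heq
  have hmem : y ∈ resonantSet ω₂ k₁ (k₁ + y - k₃) :=
    ⟨hcell k₁ k₃, by rw [resonanceFn_swap_out]; exact hres k₁ k₃⟩
  rw [htwo k₁ _ hoff, h4] at hmem
  have hyeq : y = toIocMod Real.two_pi_pos (-π) (k₁ + y - k₃) := by simpa using hmem
  obtain ⟨m, hm⟩ := exists_sub_eq_of_eq_toIocMod (hcell k₁ k₃) hyeq
  exact sub_ne_of_groupVelocity_ne hW (-m) (by push_cast; linarith)

/-- **`v₂ = v₃` forces the curve** (incoming swap `k₁ ↔ k₂`): off the equal-velocity curve,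
`v(h) ≠ v(k₃)`. -/
theorem groupVelocity_partner_ne_k3 (hcell : ∀ k₁ k₃ : ℝ, h k₁ k₃ ∈ Set.Ioc (-π) π)
    (hres : ∀ k₁ k₃ : ℝ, resonanceFn ω₂ k₁ (h k₁ k₃) k₃ = 0)
    (htwo : ∀ k₁ k₃ : ℝ, (∀ n : ℤ, k₃ - k₁ ≠ n * (2 * π)) →
      resonantSet ω₂ k₁ k₃ = {toIocMod Real.two_pi_pos (-π) k₃, h k₁ k₃})
    (htriv : ∀ k₁ k₃ : ℝ, (∀ n : ℤ, k₃ - k₁ ≠ n * (2 * π)) →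
      (h k₁ k₃ = toIocMod Real.two_pi_pos (-π) k₃ ↔ groupVelocity ω₂ k₃ = groupVelocity ω₂ k₁))
    {k₁ k₃ : ℝ} (hW : groupVelocity ω₂ k₃ ≠ groupVelocity ω₂ k₁) :
    groupVelocity ω₂ (h k₁ k₃) ≠ groupVelocity ω₂ k₃ := by
  intro heq
  set y := h k₁ k₃ with hy
  have hoff : ∀ n : ℤ, k₃ - y ≠ n * (2 * π) := fun n hn =>
    partner_sub_ne hcell htriv hW (-n) (by rw [← hy]; push_cast; linarith)
  have htr : h y k₃ = toIocMod Real.two_pi_pos (-π) k₃ := (htriv y k₃ hoff).2 heq.symm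
  have hmem : toIocMod Real.two_pi_pos (-π) k₁ ∈ resonantSet ω₂ y k₃ :=
    ⟨toIocMod_mem_cell k₁, by rw [resonanceFn_toIocMod_snd, resonanceFn_comm]; exact hres k₁ k₃⟩
  rw [htwo y k₃ hoff, htr] at hmem
  have h13 : toIocMod Real.two_pi_pos (-π) k₁ = toIocMod Real.two_pi_pos (-π) k₃ := by
    simpa using hmem
  obtain ⟨m, hm⟩ := (toIocMod_eq_toIocMod Real.two_pi_pos).1 h13
  exact sub_ne_of_groupVelocity_ne hW m (by rw [hm, zsmul_eq_mul])

/-- **The product of sines is a square at an endpoint.** If `v β = v k₁` and `Ω(k₁, L, β) = 0`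
then `sin(k₁/2) sin(L/2) sin(β/2) sin((k₁+L-β)/2)` is a square: on the diagonal `β ≡ k₁` it is
`(sin(k₁/2) sin(L/2))²`, and off it the two-root structure forces `L ≡ β`, giving
`(sin(k₁/2) sin(β/2))²`. -/
theorem prod_sin_eq_sq_of_resonant
    (htwo : ∀ k₁ k₃ : ℝ, (∀ n : ℤ, k₃ - k₁ ≠ n * (2 * π)) →
      resonantSet ω₂ k₁ k₃ = {toIocMod Real.two_pi_pos (-π) k₃, h k₁ k₃})
    (htriv : ∀ k₁ k₃ : ℝ, (∀ n : ℤ, k₃ - k₁ ≠ n * (2 * π)) →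
      (h k₁ k₃ = toIocMod Real.two_pi_pos (-π) k₃ ↔ groupVelocity ω₂ k₃ = groupVelocity ω₂ k₁))
    {k₁ β L : ℝ} (hβ : groupVelocity ω₂ β = groupVelocity ω₂ k₁) (hL : resonanceFn ω₂ k₁ L β = 0) :
    ∃ Q : ℝ, Real.sin (k₁ / 2) * Real.sin (L / 2) * Real.sin (β / 2) *
      Real.sin ((k₁ + L - β) / 2) = Q ^ 2 := by
  by_cases hd : ∃ n : ℤ, β - k₁ = n * (2 * π)
  · obtain ⟨n, hn⟩ := hd
    refine ⟨Real.sin (k₁ / 2) * Real.sin (L / 2), ?_⟩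
    have h := sin_add_mul_sin_sub_int_mul_pi (k₁ / 2) (L / 2) n
    rw [show β / 2 = k₁ / 2 + n * π by linarith, show (k₁ + L - β) / 2 = L / 2 - n * π by linarith]
    linear_combination (Real.sin (k₁ / 2) * Real.sin (L / 2)) * h
  · have hd' : ∀ n : ℤ, β - k₁ ≠ n * (2 * π) := fun n hn => hd ⟨n, hn⟩
    have htr : h k₁ β = toIocMod Real.two_pi_pos (-π) β := (htriv k₁ β hd').2 hβ
    have hmem : toIocMod Real.two_pi_pos (-π) L ∈ resonantSet ω₂ k₁ β :=
      ⟨toIocMod_mem_cell L, by rw [resonanceFn_toIocMod_snd]; exact hL⟩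
    rw [htwo k₁ β hd', htr] at hmem
    have hLβ : toIocMod Real.two_pi_pos (-π) L = toIocMod Real.two_pi_pos (-π) β := by
      simpa using hmem
    obtain ⟨m, hm⟩ := (toIocMod_eq_toIocMod Real.two_pi_pos).1 hLβ
    rw [zsmul_eq_mul] at hm
    refine ⟨Real.sin (k₁ / 2) * Real.sin (β / 2), ?_⟩
    have h := sin_add_mul_sin_add_int_mul_pi (β / 2) (k₁ / 2) (-m)
    rw [show L / 2 = β / 2 + ((-m : ℤ) : ℝ) * π by push_cast; linarith,
      show (k₁ + L - β) / 2 = k₁ / 2 + ((-m : ℤ) : ℝ) * π by push_cast; linarith]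
    linear_combination (Real.sin (k₁ / 2) * Real.sin (β / 2)) * h

/-- **Endpoint lemma.** Along any sequence `u j → β` with `v β = v k₁`, the vertex
`vertex a b k₁ (h k₁ (u j)) (u j)` (`a > 0`, `b ≥ 0`) cannot vanish identically: a cluster value
`L` of the partners is resonant at `(k₁, β)` (continuity of `Ω`), so the product of sines tends to a
square and the vertex to `≥ a > 0`. -/
theorem vertex_seq_ne_zero (hcell : ∀ k₁ k₃ : ℝ, h k₁ k₃ ∈ Set.Ioc (-π) π)
    (hres : ∀ k₁ k₃ : ℝ, resonanceFn ω₂ k₁ (h k₁ k₃) k₃ = 0)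
    (htwo : ∀ k₁ k₃ : ℝ, (∀ n : ℤ, k₃ - k₁ ≠ n * (2 * π)) →
      resonantSet ω₂ k₁ k₃ = {toIocMod Real.two_pi_pos (-π) k₃, h k₁ k₃})
    (htriv : ∀ k₁ k₃ : ℝ, (∀ n : ℤ, k₃ - k₁ ≠ n * (2 * π)) →
      (h k₁ k₃ = toIocMod Real.two_pi_pos (-π) k₃ ↔ groupVelocity ω₂ k₃ = groupVelocity ω₂ k₁))
    {a b k₁ β : ℝ} (ha : 0 < a) (hb : 0 ≤ b) (hβ : groupVelocity ω₂ β = groupVelocity ω₂ k₁)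
    {u : ℕ → ℝ} (hu : Tendsto u atTop (𝓝 β))
    (hz : ∀ j, vertex a b k₁ (h k₁ (u j)) (u j) = 0) : False := by
  obtain ⟨L, -, ψ, hψ, hyL⟩ := (isCompact_Icc : IsCompact (Icc (-π) π)).tendsto_subseq
    (x := fun j => h k₁ (u j)) fun j => Ioc_subset_Icc_self (hcell k₁ (u j))
  have hpair : Tendsto (fun j => (h k₁ (u (ψ j)), u (ψ j))) atTop (𝓝 (L, β)) :=
    hyL.prodMk_nhds (hu.comp hψ.tendsto_atTop)
  have hcΩ : Continuous fun p : ℝ × ℝ => resonanceFn ω₂ k₁ p.1 p.2 := by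
    have := continuous_dispersion (ω₂ := ω₂)
    unfold resonanceFn
    fun_prop
  have hΩL : resonanceFn ω₂ k₁ L β = 0 := by
    have h1 := (hcΩ.tendsto (L, β)).comp hpair
    have h2 : ((fun p : ℝ × ℝ => resonanceFn ω₂ k₁ p.1 p.2) ∘
        fun j => (h k₁ (u (ψ j)), u (ψ j))) = fun _ => 0 := funext fun j => hres k₁ _
    rw [h2] at h1
    exact (tendsto_nhds_unique tendsto_const_nhds h1).symm
  have hcV : Continuous fun p : ℝ × ℝ => vertex a b k₁ p.1 p.2 := by
    unfold vertex
    fun_prop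
  have hVL : vertex a b k₁ L β = 0 := by
    have h1 := (hcV.tendsto (L, β)).comp hpair
    have h2 : ((fun p : ℝ × ℝ => vertex a b k₁ p.1 p.2) ∘
        fun j => (h k₁ (u (ψ j)), u (ψ j))) = fun _ => 0 := funext fun j => hz _
    rw [h2] at h1
    exact (tendsto_nhds_unique tendsto_const_nhds h1).symm
  obtain ⟨Q, hQ⟩ := prod_sin_eq_sq_of_resonant htwo htriv hβ hΩL
  have hVQ : vertex a b k₁ L β = a + 16 * b * Q ^ 2 := by unfold vertex; rw [hQ]
  have := mul_nonneg hb (sq_nonneg Q)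
  linarith

/-- **Fibre lift.** Near a point `x` of the fibre of `k₁` off the equal-velocity curve, the branch
has an analytic lift `φ₁ ≡ h k₁ · (mod 2π)` on an interval `(x-ε, x+ε)` avoiding the curve, with
`φ₁' = (v₃ - v₄)/(v₂ - v₄)`. -/
theorem exists_fibre_lift
    (hlift : ∀ k₁ k₃ : ℝ, groupVelocity ω₂ k₃ ≠ groupVelocity ω₂ k₁ →
      ∃ (φ : ℝ × ℝ → ℝ) (U : Set (ℝ × ℝ)), U ∈ 𝓝 (k₁, k₃) ∧ AnalyticOnNhd ℝ φ U ∧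
        φ (k₁, k₃) = h k₁ k₃ ∧ (∀ p ∈ U, ∃ n : ℤ, φ p = h p.1 p.2 + n * (2 * π)) ∧
        (∀ p ∈ U, groupVelocity ω₂ p.2 ≠ groupVelocity ω₂ p.1) ∧
        (∀ p ∈ U, HasStrictFDerivAt φ
          (((groupVelocity ω₂ (p.1 + φ p - p.2) - groupVelocity ω₂ p.1) /
            (groupVelocity ω₂ (φ p) - groupVelocity ω₂ (p.1 + φ p - p.2))) •
              ContinuousLinearMap.fst ℝ ℝ ℝ +
          ((groupVelocity ω₂ p.2 - groupVelocity ω₂ (p.1 + φ p - p.2)) /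
            (groupVelocity ω₂ (φ p) - groupVelocity ω₂ (p.1 + φ p - p.2))) •
              ContinuousLinearMap.snd ℝ ℝ ℝ) p))
    (k₁ x : ℝ) (hW : groupVelocity ω₂ x ≠ groupVelocity ω₂ k₁) :
    ∃ φ₁ : ℝ → ℝ, ∃ ε > 0, (∀ k₃ ∈ Ioo (x - ε) (x + ε), AnalyticAt ℝ φ₁ k₃) ∧
      (∀ k₃ ∈ Ioo (x - ε) (x + ε), ∃ n : ℤ, φ₁ k₃ = h k₁ k₃ + n * (2 * π)) ∧
      (∀ k₃ ∈ Ioo (x - ε) (x + ε), HasDerivAt φ₁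
        ((groupVelocity ω₂ k₃ - groupVelocity ω₂ (k₁ + φ₁ k₃ - k₃)) /
          (groupVelocity ω₂ (φ₁ k₃) - groupVelocity ω₂ (k₁ + φ₁ k₃ - k₃))) k₃) := by
  obtain ⟨φ, U, hU, hφan, -, hφh, -, hφd⟩ := hlift k₁ x hW
  have hI : {y : ℝ | (k₁, y) ∈ U} ∈ 𝓝 x :=
    (continuous_const.prodMk continuous_id).continuousAt.preimage_mem_nhds hU
  obtain ⟨ε, hε, hball⟩ := Metric.mem_nhds_iff.1 hI
  rw [Real.ball_eq_Ioo] at hball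
  have hmem : ∀ k₃ ∈ Ioo (x - ε) (x + ε), (k₁, k₃) ∈ U := fun k₃ hk => hball hk
  refine ⟨fun y => φ (k₁, y), ε, hε, fun k₃ hk => ?_, fun k₃ hk => ?_, fun k₃ hk => ?_⟩
  · exact (hφan _ (hmem k₃ hk)).comp₂ analyticAt_const analyticAt_id
  · have h1 := hφh _ (hmem k₃ hk)
    dsimp only at h1
    exact h1
  · have hd := ((hφd _ (hmem k₃ hk)).hasFDerivAt.comp k₃
      (hasFDerivAt_prodMk_right k₁ k₃)).hasDerivAt
    dsimp only at hd
    refine hd.congr_deriv ?_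
    simp

/-- Along a fibre, `k₃ ↦ v(h k₁ k₃)` is analytic off the equal-velocity curve. -/
theorem analyticAt_groupVelocity_partner (hω : 0 < ω₂)
    (hfl : ∀ k₁ x : ℝ, groupVelocity ω₂ x ≠ groupVelocity ω₂ k₁ → ∃ φ₁ : ℝ → ℝ, ∃ ε > 0,
      (∀ k₃ ∈ Ioo (x - ε) (x + ε), AnalyticAt ℝ φ₁ k₃) ∧
      (∀ k₃ ∈ Ioo (x - ε) (x + ε), ∃ n : ℤ, φ₁ k₃ = h k₁ k₃ + n * (2 * π)) ∧
      (∀ k₃ ∈ Ioo (x - ε) (x + ε), HasDerivAt φ₁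
        ((groupVelocity ω₂ k₃ - groupVelocity ω₂ (k₁ + φ₁ k₃ - k₃)) /
          (groupVelocity ω₂ (φ₁ k₃) - groupVelocity ω₂ (k₁ + φ₁ k₃ - k₃))) k₃))
    {k₁ x : ℝ} (hW : groupVelocity ω₂ x ≠ groupVelocity ω₂ k₁) :
    AnalyticAt ℝ (fun k₃ => groupVelocity ω₂ (h k₁ k₃)) x := by
  obtain ⟨φ₁, ε, hε, han, hlh, -⟩ := hfl k₁ x hW
  have hx : x ∈ Ioo (x - ε) (x + ε) := ⟨by linarith, by linarith⟩
  refine ((analyticAt_groupVelocity hω _).comp (han x hx)).congr ?_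
  refine eventually_of_mem (Ioo_mem_nhds hx.1 hx.2) fun k₃ hk => ?_
  obtain ⟨n, hn⟩ := hlh k₃ hk
  show groupVelocity ω₂ (φ₁ k₃) = groupVelocity ω₂ (h k₁ k₃)
  rw [hn, groupVelocity_add_int_mul_two_pi]

/-- Along a fibre, `k₃ ↦ v(k₄)`, `k₄ = k₁ + h k₁ k₃ - k₃`, is analytic off the equal-velocity
curve. -/
theorem analyticAt_groupVelocity_k4 (hω : 0 < ω₂)
    (hfl : ∀ k₁ x : ℝ, groupVelocity ω₂ x ≠ groupVelocity ω₂ k₁ → ∃ φ₁ : ℝ → ℝ, ∃ ε > 0,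
      (∀ k₃ ∈ Ioo (x - ε) (x + ε), AnalyticAt ℝ φ₁ k₃) ∧
      (∀ k₃ ∈ Ioo (x - ε) (x + ε), ∃ n : ℤ, φ₁ k₃ = h k₁ k₃ + n * (2 * π)) ∧
      (∀ k₃ ∈ Ioo (x - ε) (x + ε), HasDerivAt φ₁
        ((groupVelocity ω₂ k₃ - groupVelocity ω₂ (k₁ + φ₁ k₃ - k₃)) /
          (groupVelocity ω₂ (φ₁ k₃) - groupVelocity ω₂ (k₁ + φ₁ k₃ - k₃))) k₃))
    {k₁ x : ℝ} (hW : groupVelocity ω₂ x ≠ groupVelocity ω₂ k₁) :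
    AnalyticAt ℝ (fun k₃ => groupVelocity ω₂ (k₁ + h k₁ k₃ - k₃)) x := by
  obtain ⟨φ₁, ε, hε, han, hlh, -⟩ := hfl k₁ x hW
  have hx : x ∈ Ioo (x - ε) (x + ε) := ⟨by linarith, by linarith⟩
  have hin : AnalyticAt ℝ (fun k₃ => k₁ + φ₁ k₃ - k₃) x :=
    (analyticAt_const.add (han x hx)).sub analyticAt_id
  refine ((analyticAt_groupVelocity hω _).comp hin).congr ?_
  refine eventually_of_mem (Ioo_mem_nhds hx.1 hx.2) fun k₃ hk => ?_
  obtain ⟨n, hn⟩ := hlh k₃ hk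
  show groupVelocity ω₂ (k₁ + φ₁ k₃ - k₃) = groupVelocity ω₂ (k₁ + h k₁ k₃ - k₃)
  rw [hn, show k₁ + (h k₁ k₃ + n * (2 * π)) - k₃ = (k₁ + h k₁ k₃ - k₃) + n * (2 * π) by ring,
    groupVelocity_add_int_mul_two_pi]

/-- Along a fibre, `k₃ ↦ vertex a b k₁ (h k₁ k₃) k₃` is analytic off the equal-velocity curve
(the product `∏ sin(k_j/2)` is lift-independent). -/
theorem analyticAt_vertex_partner
    (hfl : ∀ k₁ x : ℝ, groupVelocity ω₂ x ≠ groupVelocity ω₂ k₁ → ∃ φ₁ : ℝ → ℝ, ∃ ε > 0,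
      (∀ k₃ ∈ Ioo (x - ε) (x + ε), AnalyticAt ℝ φ₁ k₃) ∧
      (∀ k₃ ∈ Ioo (x - ε) (x + ε), ∃ n : ℤ, φ₁ k₃ = h k₁ k₃ + n * (2 * π)) ∧
      (∀ k₃ ∈ Ioo (x - ε) (x + ε), HasDerivAt φ₁
        ((groupVelocity ω₂ k₃ - groupVelocity ω₂ (k₁ + φ₁ k₃ - k₃)) /
          (groupVelocity ω₂ (φ₁ k₃) - groupVelocity ω₂ (k₁ + φ₁ k₃ - k₃))) k₃))
    (a b : ℝ) {k₁ x : ℝ} (hW : groupVelocity ω₂ x ≠ groupVelocity ω₂ k₁) :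
    AnalyticAt ℝ (fun k₃ => vertex a b k₁ (h k₁ k₃) k₃) x := by
  obtain ⟨φ₁, ε, hε, han, hlh, -⟩ := hfl k₁ x hW
  have hx : x ∈ Ioo (x - ε) (x + ε) := ⟨by linarith, by linarith⟩
  have hφ := han x hx
  have hV : AnalyticAt ℝ (fun k₃ => vertex a b k₁ (φ₁ k₃) k₃) x := by
    unfold vertex
    fun_prop
  refine hV.congr ?_
  refine eventually_of_mem (Ioo_mem_nhds hx.1 hx.2) fun k₃ hk => ?_
  obtain ⟨n, hn⟩ := hlh k₃ hk
  show vertex a b k₁ (φ₁ k₃) k₃ = vertex a b k₁ (h k₁ k₃) k₃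
  rw [hn, vertex_snd_add_int_mul_two_pi]

end PartB

end Summit.AtomisticToContinuum.FouriersLaw.Theorems.FGRGap.FoldJetRigidity.Generic

namespace Summit.AtomisticToContinuum.FouriersLaw.Theorems.FGRGap.FoldJetRigidity

/-- HELPER STUB `stub_fibreGenericity_partB` (landing vehicle of this file): off the equal-velocity
curve, `v(k₄) ≠ v(k₁)` and `v(h) ≠ v(k₃)` pointwise. -/
theorem stub_fibreGenericity_partB :
    ∀ ω₂ : ℝ, 0 < ω₂ → ∀ h : ℝ → ℝ → ℝ, (∀ k₁ k₃ : ℝ, h k₁ k₃ ∈ Set.Ioc (-π) π) → (∀ k₁ k₃ : ℝ, resonanceFn ω₂ k₁ (h k₁ k₃) k₃ = 0) → (∀ k₁ k₃ : ℝ, (∀ n : ℤ, k₃ - k₁ ≠ n * (2 * π)) → resonantSet ω₂ k₁ k₃ = {toIocMod Real.two_pi_pos (-π) k₃, h k₁ k₃}) → (∀ k₁ k₃ : ℝ, (∀ n : ℤ, k₃ - k₁ ≠ n * (2 * π)) → (h k₁ k₃ = toIocMod Real.two_pi_pos (-π) k₃ ↔ groupVelocity ω₂ k₃ = groupVelocity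 ω₂ k₁)) → ∀ k₁ k₃ : ℝ, groupVelocity ω₂ k₃ ≠ groupVelocity ω₂ k₁ → groupVelocity ω₂ (k₁ + h k₁ k₃ - k₃) ≠ groupVelocity ω₂ k₁ ∧ groupVelocity ω₂ (h k₁ k₃) ≠ groupVelocity ω₂ k₃ := by
  intro ω₂ _ h hcell hres htwo htriv k₁ k₃ hW
  exact ⟨Generic.groupVelocity_k4_ne_k1 hcell hres htwo htriv hW,
    Generic.groupVelocity_partner_ne_k3 hcell hres htwo htriv hW⟩

end Summit.AtomisticToContinuum.FouriersLaw.Theorems.FGRGap.FoldJetRigidity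

end
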